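import Summits.HodgeConjecture.CorCM.MumfordTateRankFourCM
import Summits.HodgeConjecture.CorCM.CMAbelianFivefoldPowers
import HarnessLib

/-!
# The Mumford–Tate rank `4`, CM side, III — INTRINSIC form: under `dim MT(H¹(X)) ≤ 4` all powers of a CM abelian variety
# are divisor-generated iff no elliptic-curve factor's field embeds in `End⁰` of a simple threefold factor and no
# simple fourfold factor carries Weil classes (Moonen–Zarhin (0.2) on the variety, EVERY dimension)

COR-CM (cell `pub-hodgecm2`, seat `b27` gen 32, count-neutral lane MT-RANK-FOUR-CM, file 4; theorems only, no definition,
no named fact; UNCONDITIONAL).  NEW as stated (an assembly of tree theorems), hence under `Summits/`.  HONEST FRAMING: a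
structure theorem on Mumford–Tate groups of CM abelian varieties; `HC_CM` is neither used nor asserted.

Seat b16's `CorCM/CMAbelianFivefoldPowers` (CM5-CLASSIF) states Moonen–Zarhin 1999 Thm. (0.2) for complex abelian
varieties `X` of CM type of DIMENSION `≤ 5` INTRINSICALLY — through isogeny factors (`Domination.AVDominatedBy`) and ring
embeddings of endomorphism algebras, with no realisation data: all powers of `X` are divisor-generated iff
¬(a⁺) «no elliptic curve `E` and simple `T` of dimension `3` or `4`, both factors of `X`, with `End⁰(E) ↪ End⁰(T)`» and
¬(b′) «no simple fourfold factor `F` with `B(F) ≠ D(F)`».  This file trades the dimension bound for the MUMFORD–TATE bound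
`dim MT(H¹(X)) ≤ 4` (any `dim X`), using the realisation-level classification of `CorCM/MumfordTateRankFourCM`
(`shape_of_mtRank_hodge_one_eq_four_of_not_forall_isDivisorGenerated`):

* §1 `exists_not_isDivisorGenerated_powSucc_of_curve_factor_of_ringHom` — in EVERY dimension and with NO Mumford–Tate
  hypothesis: an elliptic curve `E` and a SIMPLE abelian variety `T` of dimension `≥ 2`, both isogeny factors of a CM
  abelian variety `X`, with `End⁰(E) →+* End⁰(T)`, force an exotic Hodge class on some power `X^{N+1}` (in Milne's
  regrouping `E`, `T` are isogenous to representatives whose CM fields inherit the embedding; a SHARED imaginary quadratic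
  field makes every family degenerate — seat b23's `not_isNondegenerateFamily_of_shared_imaginary_quadratic`, no
  signature hypothesis; Hazama–Murty puts the class on a product of representatives, an isogeny factor of a power of `X`).
  This removes the hypotheses `dim X ≤ 5`, `dim T ∈ {3, 4}` of b16's `exists_not_isDivisorGenerated_powSucc_of_curve_factor`.
* §2 **`forall_isDivisorGenerated_powSucc_iff_of_isOfCMType_of_mtRank_hodge_one_le_four`** — for `X` of CM type with
  `0 < dim X` and `dim MT(H¹(X)) ≤ 4`: `(∀ N, B•(X^{N+1}) = D•(X^{N+1})) ⟺ ¬(a₃) ∧ ¬(b′)`, where (a₃) is (a⁺) with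
  `dim T = 3` (Moonen–Zarhin (0.2) (a)) and (b′) as above (Thm. (0.1) (b)); hence
  `hodgeConjectureFor_powSucc_of_isOfCMType_of_mtRank_hodge_one_le_four_of_not_shape` — the Hodge conjecture for all powers
  of such `X`, UNCONDITIONALLY, as soon as ¬(a₃) ∧ ¬(b′).

ERRATUM carried for the sibling `CorCM/MumfordTateRankLeFourHodge` (module docstring, last parenthesis): the example of an
open case at Mumford–Tate rank `5` should read «a simple CM SIXFOLD of Mumford–Tate rank `5` (Dodson's degenerate types with
`l = 3`)» — a simple CM sixfold of corank ONE has rank `6`; the theorems there are unaffected.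

## References

* [MoonenZarhin1999LowDim] B. Moonen, Yu. Zarhin, *Hodge classes on abelian varieties of low dimension*, Math. Ann.
  315 (1999) 711–733, Thm. (0.1) (a)–(b), Thm. (0.2) (a), (e)–(g), (1)–(4).
* [Gordon1999HodgeAVSurvey] B. B. Gordon, *A survey of the Hodge conjecture for abelian varieties*, §3 Theorem, 5.13,
  7.5–7.7, 9.2.
* [MumfordAV1970] D. Mumford, *Abelian Varieties*, §19 Thm. 1, Cor. 1–2.
* [Dodson1987] B. Dodson, J. Algebra 111 (1987), Thm. 1.0 and Thm. 3.2.1.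
-/

noncomputable section

open CategoryTheory CategoryTheory.Limits NumberField Module
open scoped BigOperators

namespace Summit.HodgeConjecture.CorCM

open Literature.NumberTheory.ComplexMultiplication
open Literature.AlgebraicGeometry.Motives
open Literature.AlgebraicGeometry.Motives.AbelianVariety
open Literature.AlgebraicGeometry.HodgeTheory
open Literature.AlgebraicGeometry.ComplexMultiplication (IsCMTypeRealisation)
open Literature.AlgebraicGeometry.Milne1999 (IsOfCMType)
open Literature.AlgebraicGeometry.Pohlmann1968
open Summit.HodgeConjecture.CorCM.Domination
open Summit.HodgeConjecture.HodgeConjecture.Ring2.Atlas (nonempty_ringEquiv_endAlgebra_of_isSimple)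

variable {X : AbelianVariety ℂ}

/-! ## §1 The curve obstruction in every dimension -/

section Curve

/-- **An elliptic-curve factor whose field embeds in `End⁰` of a simple factor of dimension `≠ 1` obstructs `B = D` on
some power — EVERY dimension, no Mumford–Tate hypothesis.**  Let `X` be of CM type, `E` an elliptic curve and `T` a SIMPLE
abelian variety with `dim T ≥ 2`, both isogeny factors of `X`, with a ring map `End⁰(E) →+* End⁰(T)`.  Then some power
`X^{N+1}` is NOT divisor-generated.  (Regroup `X ∼ ⨁ᵢ A'_{cls i}`; `E ∼ A'_{cls i}`, `T ∼ A'_{cls j}` with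
`K'_{cls i} ≅ End⁰(E) ↪ End⁰(T) ≅ K'_{cls j}`, `[K'_{cls i} : ℚ] = 2`: a shared imaginary quadratic field, so the family of
representatives is degenerate whatever the types; Hazama–Murty; the carrying product is an isogeny factor of a power.)
[cite: MoonenZarhin1999LowDim, Thm. (0.2) (a), (e)–(g) and (1)–(3)] [cite: Gordon1999HodgeAVSurvey, §3 Theorem and 7.5] -/
theorem exists_not_isDivisorGenerated_powSucc_of_curve_factor_of_ringHom (hcm : IsOfCMType X)
    {E T : AbelianVariety ℂ} (hE : E.dim = 1) (hT : T.IsSimple) (hT2 : 2 ≤ T.dim)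
    (hEX : AVDominatedBy E X) (hTX : AVDominatedBy T X) (e : E.endAlgebra →+* T.endAlgebra) :
    ∃ N : ℕ, ¬ IsDivisorGenerated (X.powSucc N) := by
  classical
  have hX0 : 0 < X.dim := by
    obtain ⟨s, π, N, hN, hsπ⟩ := hEX
    by_contra h0
    push Not at h0
    have hπ0 : π = 0 := hom_eq_zero_of_dim_eq_zero (Or.inl (by omega)) π
    exact (ne_zero_of_comp_eq_nsmul_id hN hsπ (by omega)).2 hπ0
  obtain ⟨C, _, K', _, _, _, Φ', A', ι', θ', m, cls, f, hA, hs, hniso, hcls, hf⟩ :=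
    exists_isIsogeny_biproduct_of_isSimple_of_isOfCMType (X := X) hX0 hcm
  haveI : Nonempty C := ⟨cls 0⟩
  have hXP : AVDominatedBy X (⨁ fun i => A' (cls i)) := AVDominatedBy.of_isIsogeny_hom hf (AVDominatedBy.refl _)
  -- `E ∼ A'_{cls i}`, `T ∼ A'_{cls j}`
  obtain ⟨i, hi⟩ := exists_isIsogenous_of_isSimple_of_avDominatedBy_biproduct (F := fun i => A' (cls i))
    (fun i => hs (cls i)) (isSimple_of_dim_le_one (by omega)) (by omega) (hEX.trans hXP)
  obtain ⟨j, hj⟩ := exists_isIsogenous_of_isSimple_of_avDominatedBy_biproduct (F := fun i => A' (cls i))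
    (fun i => hs (cls i)) hT (by omega) (hTX.trans hXP)
  have h1 : (A' (cls i)).dim = 1 := by obtain ⟨g, hg⟩ := hi; rw [← dim_eq_of_isIsogeny hg, hE]
  have hj2 : 2 ≤ (A' (cls j)).dim := by obtain ⟨g, hg⟩ := hj; rw [← dim_eq_of_isIsogeny hg]; exact hT2
  have hij : cls i ≠ cls j := fun h => by rw [h] at h1; omega
  have h2 : finrank ℚ (K' (cls i)) = 2 := by rw [finrank_eq_two_mul_dim_of_isCMTypeRealisation (hA (cls i)), h1]
  -- the embedding `K'_{cls i} ≅ End⁰(A'_{cls i}) ≅ End⁰(E) ↪ End⁰(T) ≅ End⁰(A'_{cls j}) ≅ K'_{cls j}`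
  obtain ⟨eE⟩ := nonempty_ringEquiv_endAlgebra_of_isSimple (hA (cls i)) (hs (cls i))
  obtain ⟨eT⟩ := nonempty_ringEquiv_endAlgebra_of_isSimple (hA (cls j)) (hs (cls j))
  obtain ⟨uE⟩ := hi.nonempty_endAlgebra_algEquiv
  obtain ⟨uT⟩ := hj.nonempty_endAlgebra_algEquiv
  let e' : K' (cls i) →+* K' (cls j) :=
    eT.symm.toRingHom.comp (uT.toRingEquiv.toRingHom.comp (e.comp (uE.symm.toRingEquiv.toRingHom.comp eE.toRingHom)))
  -- a shared imaginary quadratic field: the family of representatives is degenerate (b23), whatever the types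
  have hdeg : ¬ CMAlgebra.IsNondegenerateFamily Φ' :=
    not_isNondegenerateFamily_of_shared_imaginary_quadratic (k := K' (cls i)) h2 hij (RingHom.id _) e' Φ'
  obtain ⟨N, π, mm, c, hcQ, hcH, hcD⟩ := CMAlgebra.exists_exceptional_prod_of_not_isNondegenerateFamily
    (CMAlgebra.isSeparatingFamily_of_isSimple_of_pairwise_not_isIsogenous hA hs hniso) hdeg hA
  obtain ⟨M, hM⟩ := exists_avDominatedBy_biproduct_slots_powSucc hcls ⟨f, hf⟩ π
  exact ⟨M, fun hD => hcD (isDivisorGenerated_of_avDominatedBy hM hD mm c hcQ hcH)⟩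

/-- **Simple-threefold form** (Moonen–Zarhin (0.2) (a), every `dim X`): an elliptic curve `E` and a simple threefold `T`,
both isogeny factors of a CM abelian variety `X`, with `End⁰(E) →+* End⁰(T)` ⟹ some power of `X` is not
divisor-generated. [cite: MoonenZarhin1999LowDim, Thm. (0.2) (a) and (1)] -/
theorem exists_not_isDivisorGenerated_powSucc_of_curve_threefold_factor (hcm : IsOfCMType X)
    {E T : AbelianVariety ℂ} (hE : E.dim = 1) (hT : T.IsSimple) (hT3 : T.dim = 3)
    (hEX : AVDominatedBy E X) (hTX : AVDominatedBy T X) (e : E.endAlgebra →+* T.endAlgebra) :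
    ∃ N : ℕ, ¬ IsDivisorGenerated (X.powSucc N) :=
  exists_not_isDivisorGenerated_powSucc_of_curve_factor_of_ringHom hcm hE hT (by omega) hEX hTX e

end Curve

/-! ## §2 The intrinsic classification at `dim MT(H¹(X)) ≤ 4` -/

section Intrinsic

variable [HodgeTensorFacts.{0, 0}] {n : ℕ} (hX : IsSmoothProjective n X.X)

/-- **Moonen–Zarhin (0.2) on the variety under `dim MT(H¹(X)) ≤ 4`, INTRINSIC form.**  For a complex abelian variety `X`
of CM type with `0 < dim X` and `dim MT(H¹(X)) ≤ 4` (any `dim X`): every power `X^{N+1}` is divisor-generated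
(`B• = D• ⊗ ℂ`) IFF
(¬a₃) there are NO elliptic curve `E` and simple abelian threefold `T`, both isogeny factors of `X`, with a ring map
`End⁰(E) →+* End⁰(T)`, AND
(¬b′) NO simple abelian fourfold isogeny factor `F` of `X` has `B(F) ≠ D(F)`.
(⟹: §1 and `not_isDivisorGenerated_of_factor`, in every dimension; ⟸: the realisation-level classification
`shape_of_mtRank_hodge_one_eq_four_of_not_forall_isDivisorGenerated` — its fourfold `A` is a factor with `B(A) ≠ D(A)`, its
pair `E ⊨ (k; Ψ)`, `T ⊨ (K; Φ)`, `i : k →+* K` gives `End⁰(E) ≅ k ↪ K ≅ End⁰(T)` by Shimura §5.1.)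
[cite: MoonenZarhin1999LowDim, Thm. (0.1) (b), Thm. (0.2) (a) and (1)–(4)] [cite: Gordon1999HodgeAVSurvey, 5.13 and 7.5] -/
theorem forall_isDivisorGenerated_powSucc_iff_of_isOfCMType_of_mtRank_hodge_one_le_four (h0 : 0 < X.dim)
    (hcm : IsOfCMType X)
    (h4 : haveI := BettiUniverse.finite hX 1
      (BettiUniverse.hodge exists_isReal_hodgeModel_holds hX 1).mtRank ≤ 4) :
    (∀ N : ℕ, IsDivisorGenerated (X.powSucc N)) ↔
      (¬ ∃ E T : AbelianVariety ℂ, E.dim = 1 ∧ T.IsSimple ∧ T.dim = 3 ∧ AVDominatedBy E X ∧ AVDominatedBy T X ∧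
          Nonempty (E.endAlgebra →+* T.endAlgebra)) ∧
      ¬ ∃ F : AbelianVariety ℂ, F.IsSimple ∧ F.dim = 4 ∧ AVDominatedBy F X ∧ ¬ IsDivisorGenerated F := by
  classical
  haveI := BettiUniverse.finite hX 1
  constructor
  · intro hall
    refine ⟨?_, ?_⟩
    · rintro ⟨E, T, hE, hT, hT3, hEX, hTX, ⟨e⟩⟩
      obtain ⟨N, hN⟩ := exists_not_isDivisorGenerated_powSucc_of_curve_threefold_factor hcm hE hT hT3 hEX hTX e
      exact hN (hall N)
    · rintro ⟨F, -, -, hFX, hF⟩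
      exact not_isDivisorGenerated_of_factor hFX hF (hall 0)
  · rintro ⟨hna, hnb⟩
    by_contra hnot
    have h4' : (BettiUniverse.hodge exists_isReal_hodgeModel_holds hX 1).mtRank = 4 := by
      by_contra hne
      exact hnot (forall_isDivisorGenerated_powSucc_of_mtRank_hodge_one_le_three hX h0 hcm (by omega))
    rcases shape_of_mtRank_hodge_one_eq_four_of_not_forall_isDivisorGenerated hX h0 hcm h4' hnot with
      ⟨A, m, hs, hA4, -, hnd, -, hXB⟩ |
      ⟨K, k, _, _, _, _, _, _, Φ, Ψ, T, E, ιT, θT, ιE, θE, i, m, κ, h6, h2, hT, hTs, hT3, hE, hE1, -, hκ, hXB⟩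
    · -- (b′): the simple fourfold `A` is an isogeny factor of `X ∼ ⨁ A`
      have hPX : AVDominatedBy (⨁ fun _ : Fin (m + 1) => A) X :=
        AVDominatedBy.of_isIsogenous hXB.symm' (AVDominatedBy.refl X)
      exact hnb ⟨A, hs, hA4, (avDominatedBy_biproduct_summand (fun _ : Fin (m + 1) => A) 0).trans hPX, hnd⟩
    · -- (a₃): `E` and `T` are isogeny factors of `X ∼ ⨁_j ![E, T] (κ j)`, and `End⁰(E) ≅ k ↪ K ≅ End⁰(T)`
      have hPX : AVDominatedBy (⨁ fun j => (![E, T] : Fin 2 → AbelianVariety ℂ) (κ j)) X :=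
        AVDominatedBy.of_isIsogenous hXB.symm' (AVDominatedBy.refl X)
      obtain ⟨j₀, hj₀⟩ := hκ 0
      obtain ⟨j₁, hj₁⟩ := hκ 1
      have hEP : AVDominatedBy E (⨁ fun j => (![E, T] : Fin 2 → AbelianVariety ℂ) (κ j)) := by
        have h := avDominatedBy_biproduct_summand (fun j => (![E, T] : Fin 2 → AbelianVariety ℂ) (κ j)) j₀
        simp only [hj₀] at h
        simpa using h
      have hTP : AVDominatedBy T (⨁ fun j => (![E, T] : Fin 2 → AbelianVariety ℂ) (κ j)) := by
        have h := avDominatedBy_biproduct_summand (fun j => (![E, T] : Fin 2 → AbelianVariety ℂ) (κ j)) j₁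
        simp only [hj₁] at h
        simpa using h
      obtain ⟨eE⟩ := nonempty_ringEquiv_endAlgebra_of_isSimple hE (isSimple_of_dim_le_one hE1.le)
      obtain ⟨eT⟩ := nonempty_ringEquiv_endAlgebra_of_isSimple hT hTs
      exact hna ⟨E, T, hE1, hTs, hT3, hEP.trans hPX, hTP.trans hPX,
        ⟨eT.toRingHom.comp (i.comp eE.symm.toRingHom)⟩⟩

/-- **The Hodge conjecture for all powers, unconditionally, outside the two shapes (intrinsic form)**: `X` of CM type with
`0 < dim X`, `dim MT(H¹(X)) ≤ 4`, ¬(a₃) and ¬(b′) ⟹ every power `X^{N+1}` is divisor-generated and satisfies the Hodge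
conjecture. [cite: MoonenZarhin1999LowDim, Thm. (0.2) (4)] [cite: Gordon1999HodgeAVSurvey, 7.5 and 10.10] -/
theorem hodgeConjectureFor_powSucc_of_isOfCMType_of_mtRank_hodge_one_le_four_of_not_shape (h0 : 0 < X.dim)
    (hcm : IsOfCMType X)
    (h4 : haveI := BettiUniverse.finite hX 1
      (BettiUniverse.hodge exists_isReal_hodgeModel_holds hX 1).mtRank ≤ 4)
    (hna : ¬ ∃ E T : AbelianVariety ℂ, E.dim = 1 ∧ T.IsSimple ∧ T.dim = 3 ∧ AVDominatedBy E X ∧ AVDominatedBy T X ∧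
      Nonempty (E.endAlgebra →+* T.endAlgebra))
    (hnb : ¬ ∃ F : AbelianVariety ℂ, F.IsSimple ∧ F.dim = 4 ∧ AVDominatedBy F X ∧ ¬ IsDivisorGenerated F) (N : ℕ) :
    IsDivisorGenerated (X.powSucc N) ∧ HodgeConjectureFor (X.powSucc N).dim (X.powSucc N).X :=
  have hD := (forall_isDivisorGenerated_powSucc_iff_of_isOfCMType_of_mtRank_hodge_one_le_four hX h0 hcm h4).2
    ⟨hna, hnb⟩ N
  ⟨hD, hodgeConjectureFor_of_isDivisorGenerated _ hD⟩

/-- **Contrapositive display**: a CM abelian variety with `dim MT(H¹(X)) ≤ 4` carrying an exotic Hodge class on some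
power has `dim MT(H¹(X)) = 4` and an elliptic-curve/simple-threefold factor pair with `End⁰(E) ↪ End⁰(T)`, or a simple
fourfold factor with `B ≠ D`. [cite: MoonenZarhin1999LowDim, Thm. (0.1) (b) and Thm. (0.2) (a)] -/
theorem exists_shape_of_not_forall_isDivisorGenerated_of_mtRank_hodge_one_le_four (h0 : 0 < X.dim)
    (hcm : IsOfCMType X)
    (h4 : haveI := BettiUniverse.finite hX 1
      (BettiUniverse.hodge exists_isReal_hodgeModel_holds hX 1).mtRank ≤ 4)
    (hnot : ¬ ∀ N : ℕ, IsDivisorGenerated (X.powSucc N)) :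
    haveI := BettiUniverse.finite hX 1
    (BettiUniverse.hodge exists_isReal_hodgeModel_holds hX 1).mtRank = 4 ∧
      ((∃ E T : AbelianVariety ℂ, E.dim = 1 ∧ T.IsSimple ∧ T.dim = 3 ∧ AVDominatedBy E X ∧ AVDominatedBy T X ∧
          Nonempty (E.endAlgebra →+* T.endAlgebra)) ∨
        ∃ F : AbelianVariety ℂ, F.IsSimple ∧ F.dim = 4 ∧ AVDominatedBy F X ∧ ¬ IsDivisorGenerated F) := by
  haveI := BettiUniverse.finite hX 1
  have h4' : (BettiUniverse.hodge exists_isReal_hodgeModel_holds hX 1).mtRank = 4 := by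
    by_contra hne
    exact hnot (forall_isDivisorGenerated_powSucc_of_mtRank_hodge_one_le_three hX h0 hcm (by omega))
  refine ⟨h4', ?_⟩
  by_contra hno
  push Not at hno
  exact hnot ((forall_isDivisorGenerated_powSucc_iff_of_isOfCMType_of_mtRank_hodge_one_le_four hX h0 hcm h4).2
    ⟨fun h => by obtain ⟨E, T, h1, h2, h3, h4, h5, ⟨e⟩⟩ := h; exact (hno.1 E T h1 h2 h3 h4 h5).false e,
      fun h => by obtain ⟨F, h1, h2, h3, h4⟩ := h; exact h4 (hno.2 F h1 h2 h3)⟩)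

end Intrinsic

end Summit.HodgeConjecture.CorCM

end
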